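import Mathlib
import HarnessLib
import HarnessLib.Audit
import Summits.SmoothPoincare4.Statement
import Literature.Topology.FourManifolds.HomotopySpheres
import Literature.Topology.FourManifolds.HomotopyS4CompactProofs
import Literature.Topology.FourManifolds.HomotopyS4OrientableProofs
import Literature.Topology.FourManifolds.SphereSimplyConnected
import Literature.Topology.FourManifolds.GluckTwist
import Literature.Geometry.Lorentzian.PseudoRiemannianMetric
import Literature.Geometry.Lorentzian.LeviCivita
import Literature.Geometry.Lorentzian.Isometry
import Literature.Geometry.Riemannian.WeylEnergy
import HarnessLib.Audit.Status.Attr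

/-!
Route: WeylBudget

DORMANT since 2026-08-25T11:05:40Z (reconciler: no traction for 7.6 d (last activity item-evidence-added at 2026-08-17T19:13:08Z); parked, not closed — `ledger route dormant route-SmoothPoincare4-WeylBudget --off` to reactivate) — unstaffed, not closed; items shared with open routes are served there. `ledger route dormant <id> --off` reactivates.

# Route WeylBudget — the 8π² Weyl budget — CGY recognition plus isometric cork regluing of
Weyl-light PSC metrics on S⁴

It suffices to show X = WeylLight: every homotopy 4-sphere Σ carries a Riemannian metric of positive
scalar curvature whose
Weyl energy ∫_Σ ‖W‖² dV (‖·‖ = norm of W as a symmetric operator on Λ², i.e. ¼ W_ijkl W^ijkl) is <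
8π² = 4π²·χ(Σ) —
equivalently, and this is the Lean form (rev 1), `g.weylEnergy` = ∫_Σ |W_g|² dV_g < 32π² in the
(0,4)-norm |W|² = W_ijkl W^ijkl of
the fact-free `Literature/Geometry/Riemannian/WeylEnergy.lean` (Chang–Gursky–Yang's normalisation
(0.3); the identity
|W|² = 4·¼(‖Å‖²_F + ‖C̊‖²_F) through Hamilton's blocks A, C and ∫|W|² = 4∫w are PROVED as
`weylNormSq_eq_four_mul` /
`weylEnergy_eq_lintegral_four_mul` in `ChangGurskyYangWeylBudget.lean`). By Chang–Gursky–Yang 2003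
Thm A (Y[g] > 0 and ∫|W|²_(0,4) < 16π²χ ⇒ M ≅ S⁴ or ℝP⁴; π₁ = 1 kills ℝP⁴; scal > 0 ⇒ Y > 0) X ⇒
SPC4, and SPC4 ⇒ X (round
metric, W ≡ 0), so X ⇔ SPC4 modulo a 2003 theorem, carried by the route as the listed named-fact
item ChangGurskyYang (verbatim
`Literature.Geometry.Riemannian.changGurskyYang_sphere_four`). The LINE OF ATTACK on X (card
weyl-budget-cork-regluing) is transport, not
analysis on the unknown manifold: present Σ as a cork twist of S⁴ (cork theorem) and find a PSC
metric on the STANDARD S⁴ with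
Weyl energy under budget whose two pieces (cork C, exterior V) re-embed isometrically into Σ (crux
CorkRegluingBudget); scalar
curvature and the Weyl density are pointwise local, so they transfer verbatim (support
BudgetTransfer).
Lean: `∀ S : Literature.Topology.FourManifolds.HomotopySphere 4, ∃ g :
Literature.Geometry.Lorentzian.PseudoRiemannianMetric (𝓡 4) ∞ (EuclideanSpace ℝ (Fin 4))
(TangentSpace (𝓡 4) : S.carrier → Type _), ∃ _ : g.HasLeviCivita, g.IsRiemannian ∧ (∀ x, 0 <
g.scalarCurvature x) ∧ g.weylEnergy < ENNReal.ofReal (32 * Real.pi ^ 2)`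

## Assembly
DECIDING THEOREM `closes (hW : WeylLight) (hCGY : ChangGurskyYang) … : SmoothPoincare4` (rev 1),
PROVED sorry-free (axioms propext /
Classical.choice / Quot.sound; all eight items are hypotheses, two are used): for M ≃ₕ S⁴ the proved
facts
`compactSpace_of_homotopyEquiv_sphere_four_holds`, `simplyConnectedSpace_sphere_four_holds` (with
`HomotopyEquiv.simplyConnectedSpace`)
and `isOrientable_of_homotopyEquiv_sphere_four_holds` package M as a simply connected
`HomotopySphere 4`; WeylLight supplies the
Weyl-light PSC metric and the named-fact item ChangGurskyYang (Chang–Gursky–Yang 2003 Thm A, simply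
connected scal > 0 case, Weyl
energy < 32π²) returns M ≃ₘ S⁴, i.e. SmoothPoincare4. The optional item Assembly records the spine
of the line,
ChangGurskyYang → CorkRegluingBudget → BudgetTransfer → SmoothPoincare4 (provable now by the same
argument, `assembly_holds` in the
planner's Sketch.lean).

Rationale: WHY THIS LINE. Route PIC asks for POINTWISE curvature conditions (PIC, LCF) on Σ, and no
construction of such metrics survives the codimension-2
regluings by which homotopy 4-spheres arise (MicallefWang1993, Hoelzel2016). Chang–Gursky–Yang's
recognition theorem
(ChangGurskyYang2003 Thm A; ChenZhu2014) needs only the SIGN of the Yamabe constant and an L² BUDGET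
for W, both conformally
invariant and the latter exactly additive under cut-and-paste; and every homotopy 4-sphere is S⁴ cut
along the boundary Y of a
compact contractible C and reglued by an involution τ (CurtisFreedmanHsiangStong1996, Matveyev1996,
AkbulutMatveyev1998 + Θ₄ = 0,
KervaireMilnor1963) — codimension ONE, where a regluing by an isometry of the collar germ costs
nothing. So SPC4 becomes a
variational problem on the pair (S⁴ ⊃ Y, τ): the infimum of ∫‖W‖² over PSC metrics on S⁴ whose
normal jet along Y is
τ-invariant, against the explicit budget 8π² (two thirds of a Fubini–Study ℂP²), with a Chern–Simons
floor ≤ 6π² and no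
index-theoretic lower bound (Gursky1998's Weyl gap needs b⁺ > 0; Kobayashi1985/AkutagawaEtAl2003 for
the functional). Imported:
conformal geometry / fully nonlinear PDE (CGY, as a named fact), PSC-with-boundary flexibility
(GromovLawson1980, BarHanke2023),
cork theory. No spectral or probabilistic reformulation is used; the negatives index is empty.

RANKED CRUXES. #0 WeylLight (target) — every homotopy 4-sphere Σ admits a Riemannian metric g with
scal_g > 0 everywhere and Weyl energy `g.weylEnergy` = ∫_Σ |W_g|² dV_g < 32π² in the (0,4)-norm of
WeylEnergy.lean, = 8π² in the operator norm on Λ² (the card's w(Σ) < 8π² with the Yamabe-positive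
class represented by its PSC member; rev 1: the inline block density against `riemVolume` replaced
by the fact-free `weylEnergy`, same quantity by the proved `weylEnergy_eq_lintegral_four_mul`). (why
it might fail: ⇔ SPC4 mod ChangGurskyYang2003 (an exotic Σ is Weyl-heavy, ∫‖W‖² ≥ 8π², in every PSC
conformal class); as a programme nothing bounds ∫‖W‖² on a manifold not yet identified with S⁴
except transport from S⁴ — the cruxes below.) [ChangGurskyYang2003, ChenZhu2014, Kobayashi1985,
AkutagawaEtAl2003, Gursky1998]
#2 CorkRegluingBudget (crux) — for every homotopy 4-sphere Σ there are a compact contractible piece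
C and an exterior piece V (smooth 4-manifolds with boundary), smooth embeddings jC, jV covering S⁴
and kC, kV covering Σ (pieces meeting only along ∂C-images — the cork-twist presentation of the cork
theorem), and Riemannian metrics g on S⁴, γ on Σ inducing THE SAME piece metrics (jC*g = kC*γ, jV*g
= kV*γ: isometric regluing), with scal_g > 0 and `g.weylEnergy` < 32π² ((0,4)-norm; = 8π² operator
norm). Card item X_cork: κ(e,τ) < 8π², PSC-representative form. [difficulty: open-problem] (why it
might fail: the regluable-PSC class on S⁴ (metric AND second fundamental form τ-invariant along the
cork boundary Y) may be empty — only its mean-convex half is free (LawsonMichelsohn1984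
doi:10.1007/bf01388830, route-review gen-2) — or its Weyl infimum may be ≥ 32π² (bending energy of
the knotted homology sphere Y ⊂ S⁴; CS floor ≤ 6π²).) [ChangGurskyYang2003,
CurtisFreedmanHsiangStong1996, Matveyev1996, AkbulutMatveyev1998, BarHanke2023, KirbyCorks1996,
doi:10.1007/bf01388830, arXiv:2201.01263]
#3 CorkRegluablePsc (crux) — the qualitative half of the budget crux: every homotopy 4-sphere is an
ISOMETRIC cork regluing of SOME positive-scalar-curvature metric on S⁴ (same presentation data, no
Weyl bound). Everything is built on the standard sphere: a PSC metric on S⁴ whose normal jet along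
the cork boundary Y is τ-invariant; it already yields PSC on every homotopy 4-sphere (support
RegluablePscGivesPsc = route PIC's crux PicPscV2). [difficulty: L] (why it might fail: PSC boundary
deformations are mean-curvature monotone from ONE side (BarHanke2023 master theorem), so a two-sided
τ-symmetric germ along a hyperbolic homology sphere Y ⊂ S⁴ may be obstructed (a 'PSC wall'); it
implies PSC on every homotopy 4-sphere, open (KumarSen2025: only up to homeomorphism).)
[BarHanke2023, GromovLawson1980, AkbulutMatveyev1998, KumarSen2025, SchoenYau1979]
#4 WeylLightGluck (crux) — test family: every Gluck twist X of S⁴ along a 2-knot K carries a PSC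
metric with `g.weylEnergy` < 32π² ((0,4)-norm; = 8π² operator norm) (card crux 3: twisted-filling
cost c_tw of S²×D² with the Gluck boundary germ plus the conformal bending energy of K stays under
budget). Mod CGY this is the Gluck twist conjecture, attacked by an energy estimate instead of
handle moves. [difficulty: open-problem] (why it might fail: the Gluck map is an isometry of NO
metric on S²×S¹ (its powers are C¹-unbounded), so regluing is never isometric: the twisted filling
of S²×D² has a fixed Weyl cost and making S⁴ PSC-product-like near a knotted K costs bending energy;
the sum may exceed 8π² even for ribbon knots.) [Gluck1962, ChangGurskyYang2003, MicallefWang1993,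
Hoelzel2016]
#9 BudgetTransfer (support) — transfer lemma (the card's engine, analysis-free): an isometric
regluing transports scalar curvature pointwise (naturality of Levi-Civita/curvature under local
isometries on the open piece interiors, continuity + compactness of S⁴ at seam points) and preserves
the Weyl energy (piece boundaries are null sets, embeddings are measure-preserving onto their
images); hence CorkRegluingBudget → WeylLight. [difficulty: L] [Besse1987, ONeill1983, Federer1969]
#9 RegluablePscGivesPsc (support) — the same locality argument without the energy bookkeeping:
CorkRegluablePsc gives a PSC metric on every homotopy 4-sphere (conclusion stated verbatim as route
PIC's crux PicPscV2, so closing CorkRegluablePsc closes stmt-SmoothPoincare4-0442 through this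
glue). [difficulty: M] [ONeill1983, Besse1987]
#9 ChangGurskyYang (support; rev 1) — NAMED-FACT ITEM, the recognition step of the deciding theorem:
verbatim the text of `Literature.Geometry.Riemannian.changGurskyYang_sphere_four` (Chang–Gursky–Yang
2003 Thm A, simply connected scal > 0 case: a compact simply connected smooth 4-manifold with a
Riemannian metric of scal > 0 and Weyl energy < 32π² is diffeomorphic to S⁴; deep theorem, no
`_holds`), inlined rather than imported so that the route's dependency cone stays fact-free
(ChangGurskyYang.lean, §Cone hygiene); it closes by `exact h` from any discharge of the fact and is
not a prover task. needs-fact: Literature.Geometry.Riemannian.changGurskyYang_sphere_four.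
[difficulty: XL] [ChangGurskyYang2003, arXiv:math/0309287, Margerin1998, LeeParker1987]
#1 Assembly (assembly; rev 1) — ChangGurskyYang → CorkRegluingBudget → BudgetTransfer →
SmoothPoincare4 (the inline CGY hypothesis of rev 0 is now the listed item; provable now,
`assembly_holds`).

TWO-LAYER PLAN. Once CorkRegluablePsc or a special case closes: CorkRegluingBudget ⇐
CorkRegluablePsc → (BendingBudget: the regluable-PSC class on
S⁴ contains a metric with ∫‖W‖² < 8π²) → CorkRegluingBudget; CorkRegluablePsc ⇐ (SymmetricGerm: a
PSC metric on S⁴ with τ-invariant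
metric + second fundamental form on the cork boundary Y) → (JetFlexibility: higher normal jets made
τ-invariant keeping PSC,
BarHanke2023 local flexibility) → CorkRegluablePsc; WeylLightGluck ⇐ (TwistedFillingCost c_tw,
kit-computable ODE) → (knot bending
energy bound) → WeylLightGluck. k ≤ 3 each, depth 1; nothing filed now.

KILL CRITERIA. A refutation of WeylLight or of CorkRegluingBudget for a specific Σ exhibits an
exotic 4-sphere (¬SPC4): the route closes with the
problem. A proof that the regluable-PSC class is EMPTY for some cork presentation (PSC wall) does
not refute the ∃-form cruxes but
kills the PSC-representative mechanism: pivot by `--restate` to the card's weaker Neumann-bracketed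
Yamabe-positivity version of
κ(e,τ) once H¹/conformal-Laplacian vocabulary on compact pieces exists. A theorem 'regluable PSC
classes on S⁴ along a knotted
homology sphere always have ∫‖W‖² ≥ 8π²' (Willmore-type gap) closes the route
`refuted:CorkRegluingBudget`-in-substance →
`close --reason exhausted`. SPC4 proved elsewhere moots everything (round metric).

NOT DECOMPOSED YET. The Neumann-bracketing form of Yamabe positivity on pieces (card step 3; needs
Sobolev/conformal-Laplacian forms on compact
manifolds with boundary — not in the library); the Chern–Simons floor 12π²‖ΔCS‖ (card step 4;
conformal Chern–Simons invariant of
3-manifolds not in the library); the explicit cork-theorem presentation with involution τ (enters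
only as the reason the ∃-form
cruxes are plausible; Literature.Topology.FourManifolds.corkDecomposition is itself still reduced to
Milnor/Matveyev leaves); the
constants c_tw, w₀ of the Gluck variant (kit ODE jobs, layer 2). Rev 1 (route-repair, cone): no item
imports or assumes an
unproved Literature fact — the cork theorem (`Literature.Topology.FourManifolds.corkDecomposition`,
`Matveyev1996_decomposition`) is
the heuristic behind the ∃-form cruxes and will be wanted by their PROVERS (cf. the proved packaging
`HomotopySphere.exists_corkPresentation_of_facts`), not by the statements or the glue; the
Ricci-flow / Cerf / Gluck-homeomorphism
facts of the rev-0 cone rode in on `CanonicalNeighbourhoods.lean` (home of `riemVolume`) and are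
gone with it; the one fact the
line genuinely rests on, CGY Thm A, is the listed item ChangGurskyYang (needs-fact:
Literature.Geometry.Riemannian.changGurskyYang_sphere_four).

CHEAPEST FALSIFIER. (a) [rev 1: DOWNGRADED by route-review gen-2 — by Lawson–Michelsohn 1984
(doi:10.1007/bf01388830, via arXiv:2201.01263 Thm 1.3)
every cork in S⁴ is isotopic to a strictly mean-convex domain of the ROUND metric and the umbilic
germ dt² + f²h_τ is PSC for any
τ-invariant h_τ, so no sign-of-H argument yields a 'PSC wall'; what remains is a Gromov fill-in
problem with PRESCRIBED τ-symmetric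
boundary metric on the cork side] Literature/short argument for a PSC WALL: show that for the
Akbulut–Mazur cork (∂ = Σ(2,5,7)) in
its standard embedding S⁴ = C ∪ C̄ no PSC metric on S⁴ has τ-invariant metric and second fundamental
form along ∂C — would kill the
PSC-representative form of both cruxes at once; (b) [now the cheapest] compute numerically the Weyl
energy of ONE explicit
regluable PSC metric for that cork (doubled torpedo/Gromov–Lawson handle metrics): if every
reasonable candidate is far above 8π²
for the simplest cork whose twist is KNOWN to be S⁴, the budget criterion is too weak to matter. I
could run neither here (no
explicit cork metric in kit form yet).

NUMBERS. Budget: CGY Thm A ∫|W|²_(0,4) < 16π²χ(M) = 32π² ⇔ ∫‖W‖²_op < 4π²χ = 8π² for χ = 2 (Lean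
statements use the (0,4)-norm bound `g.weylEnergy < ENNReal.ofReal (32 * Real.pi ^ 2)`; |W|²_(0,4) =
4‖W‖²_op is `weylNormSq_eq_four_mul`) (arXiv:math/0309287 p.1 Thm A, p.2 Remark 2 and (0.4),
read this session). Checks of the convention: round S⁴: W = 0, ∫R²/24 = 16π² = 8π²χ; Fubini–Study
ℂP²: ∫‖W⁺‖² = 12π² (= the sharp
equality case 4π²χ(ℂP²), CGY Thm B/C), signature 12π²τ = ∫(‖W⁺‖² − ‖W⁻‖²). Hamilton blocks: φᵢ of
squared length 2, unit S⁴ has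
A = C = 2·1₃, so ‖W‖² = ¼(‖Å‖²_F + ‖C̊‖²_F). Chern–Simons floor of the card ≤ 6π² < 8π². Items at
open: 7 (1 target, 3 cruxes,
2 support, 1 assembly); rev 1: 8 (+ support ChangGurskyYang).

DEFINITION REQUESTS. (1) FULFILLED (rev 1): `PseudoRiemannianMetric.weylEnergy` / `weylNormSq` of
the fact-free
Literature/Geometry/Riemannian/WeylEnergy.lean now replace the inline `∃ w, (∀ x e,
IsOrthonormalFrame → w x = …) ∧ ∫⁻ … ∂g.riemVolume`
clause (equivalence: `weylEnergy_eq_lintegral_four_mul`, ChangGurskyYangWeylBudget.lean). (2)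
FULFILLED: the CGY fact is
`Literature.Geometry.Riemannian.changGurskyYang_sphere_four` (ChangGurskyYang.lean, no `_holds`),
carried as the listed item ChangGurskyYang.

Novelty: Searches (2026-08-15): `lit read arxiv:math/0309287 --pages 1-4` (Thm A/B/C, norm remark; no
homotopy-sphere/cork content);
`lit search --source crossref "conformally invariant sphere theorem Weyl energy positive scalar
curvature cork"` (15: CGY itself,
Gu–Xu, Catino, Bär–Hanke-adjacent PSC items, nothing joining CGY to corks/Gluck twists); `lit search
--source crossref "boundary
conditions for scalar curvature deformation mean convex doubling"` (10: BarHanke2023, Escobar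
1992/1996); `lit search --hybrid
--source local "Weyl curvature L2 energy positive Yamabe cut and paste hypersurface isometric
involution"` (10 textbook hits, none
relevant); `lit galaxy search "Weyl functional homotopy 4-sphere" --star all` (0), `"positive scalar
curvature cork" --star pdf` (0);
`lit frontier SmoothPoincare4 --since 2020` (30 rows, no conformal-geometry item);
zbMATH/OpenAlex/S2/arXiv APIs rate-limited (429)
this session; plus the card's and two auditors' searches (zbMATH 'Chang Gursky Yang', 'Weyl
functional positive Yamabe', 'cork
twist Riemannian metric', LeBrun survey arXiv:math/0404251 grep).
Nearest prior art found: ChangGurskyYang2003 (doi:10.1007/s10240-003-0017-z, the recognition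
theorem; 'exotic ⇒ Weyl-heavy' is its
unprinted corollary), Kobayashi1985 + AkutagawaEtAl2003 (the functional inf ∫‖W‖² on the
Yamabe-positive cone, Gursky1998 gap only
for b⁺ > 0), CurtisFreedmanHsiangStong1996 / Matveyev1996 / AkbulutMatveyev1998 (cork presentation),
BarHanke2023 (PSC boundary
flexibilit  [refs: 10.1007/s10240-003-0017-z, math/0309287, math/0404251, arxiv:math/0309287, doi:10.1007/s10240-003-0017-z, BarHanke2023, ChangGurskyYang2003, Kobayashi1985, AkutagawaEtAl2003, Gursky1998, CurtisFreedmanHsiangStong1996, Matveyev1996, AkbulutMatveyev1998]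

Barriers (technique_class: weyl-l2-budget, cgy-pinching, cork-regluing): - technique_class: weyl-l2-budget, cgy-pinching, cork-regluing
- Literature.Barriers.SmoothPoincare4.HCobordismBarrierFour: not invoked — the h-cobordism/cork
theorem only DESCRIBES Σ as a regluing of S⁴; the diffeomorphism comes from CGY's curvature
recognition, never from 'h-cobordant ⇒ diffeomorphic'.
- Literature.Barriers.SmoothPoincare4.ContractibleBarrierFour: compatible — we never claim τ extends
over C; the twist is undone globally on the closed manifold (CGY needs closed, χ > 0), which has no
analogue for C rel ∂.
- Literature.Barriers.SmoothPoincare4.RelativeContractibleBarrierFour: same — no relative (rel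
boundary) diffeomorphism of contractible pieces is asserted; pieces are only re-embedded
isometrically.
- Literature.Barriers.SmoothPoincare4.OneStabilisationBarrier: not applicable (no stabilisation;
∫‖W‖² is not stable under # S²×S² or # ℂP²: the budget jumps 8π² → 12π²).
- Literature.Barriers.SmoothPoincare4.TwistedSphereBarrierFour: consistent (positive side; Γ₄ = 0
unused; a presentation with C a 4-ball is allowed by the ∃-form and is exactly the trivial case).
- Literature.Barriers.SmoothPoincare4.GluckTwistCP2Barrier: blocks invariant-based REFUTATIONS of
Gluck twists; WeylLightGluck is a positive-side construction criterion and ∫‖W‖²-minimisation is not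
ℂP²-stable, so the blindness does not transfer.
- Literature.Barriers.SmoothPoincare4.GaugeSumBarrierFour: idem (no gauge-theoretic invariant is
used; w(Σ) = inf ∫‖W‖² over PSC classes is a smooth invariant

Novelty grade: new-combination — route-review gen-2 (refuter fb96e753-g2), incremental; gen-0/gen-1 (13:47) verdicts STAND: 7 decls rc0 (W3.lean); 8pi^2 budget pinned (ChangGurskyYangWeylBudget.lean); junk screening negative; design objection r2 <=> SPC4, r3 => PSC-ALL mod CGY/transfer: file layer 2. GEN-2 DELTAS: (1) glue.extra-hy (refuter refuter-rreview-route-QuantumAdvantage-D-fb96e753-g2-0, 2026-08-15T14:29:42Z; prior: doi:10.1007/s10240-003-0017-z,CurtisFreedmanHsiangStong1996,Matveyev1996,BarHanke2023,Gursky1998,doi:10.1007/bf01388830,arxiv:2201.01263)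

History (route lifecycle, newest last):
- 2026-08-15T16:24:50Z · rev 1: restated WeylLight (stmt-SmoothPoincare4-3204), CorkRegluingBudget (stmt-SmoothPoincare4-3205), WeylLightGluck (stmt-SmoothPoincare4-3207), Assembly (stmt-SmoothPoincare4-3210) — route-repair rbadge-g4 (glue+cone): (i) rev-0 Assembly took CGY Thm A inline -> new listed support item ChangGurskyYang = verbatim tex (planner-rbadge-SmoothPoincare4-WeylBudget-070d83c1-g4-0)
- 2026-08-16T04:19:40Z · AUTO-CRUX (backfill): WeylLight — hypotheses of the deciding theorem that nothing in the route derives are cruxes (operator:999:1085951)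
- 2026-08-25T11:05:40Z · DORMANT — reconciler: no traction for 7.6 d (last activity item-evidence-added at 2026-08-17T19:13:08Z); parked, not closed — `ledger route dormant route-SmoothPoincare4- (operator:999:2768619)

sub-problem: SmoothPoincare4 · status: dormant · opened planner-plancard-SmoothPoincare4-SmoothPoinca-25243e04-0 2026-08-15T11:12:58Z · rev 1 · ledger route-SmoothPoincare4-WeylBudget
GENERATED by the gate from the ledger (D-0016/17). Provers cite these decls: `theorem foo : Summit.SmoothPoincare4.SmoothPoincare4.Theses.WeylBudget.<Decl> := …` in Summits/SmoothPoincare4/SmoothPoincare4/Theorems/<Name>.lean.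
-/

namespace Summit.SmoothPoincare4.SmoothPoincare4.Theses.WeylBudget

open scoped BigOperators Topology Manifold Classical MeasureTheory ProbabilityTheory Matrix InnerProductSpace ComplexConjugate ContinuousMap ContDiff
open Filter Set Function TopologicalSpace MeasureTheory

attribute [summit_statement] _root_.SmoothPoincare4

open Literature.SPC4

-- earlier WeylLight (stmt-SmoothPoincare4-3204, replaced 2026-08-15T16:24:50Z -> stmt-SmoothPoincare4-10830): retired by None — ∀ (S : Literature.Topology.FourManifolds.HomotopySphere 4) [T3Space S.carrier] [MeasurableSpace S.carrier] [BorelSpace S.carrier], ∃ g : Literature.Geometry.Lorentzian.PseudoRiemannianMetric (𝓡 4) ∞ (EuclideanSpace ℝ (Fin 4)) (TangentSpace (𝓡 4) : S.carrier → Type _), ∃ _ :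
/-- item stmt-SmoothPoincare4-10830 · crux (kind.auto-crux: conjecture-grade) · rank 0 · open · by planner
why it might fail: ⇔ SPC4 mod ChangGurskyYang2003 (an exotic Σ is Weyl-heavy: ∫|W|² ≥ 32π² in every PSC conformal class); as a programme nothing bounds the Weyl energy on a manifold not yet identified with S⁴ except transport from S⁴ — the cruxes below.
sources: ChangGurskyYang2003, ChenZhu2014, Kobayashi1985, AkutagawaEtAl2003, Gursky1998
[target] every homotopy 4-sphere Σ admits a Riemannian metric g with scal_g > 0 everywhere and Weyl
energy `g.weylEnergy` = ∫_Σ |W_g|² dV_g < 32π² in the (0,4)-norm |W|² = W_ijkl W^ijkl of the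
fact-free WeylEnergy.lean — = 8π² = 4π²χ(Σ) in the End(Λ²)-norm of the thesis (the identities |W|² =
4·¼(‖Å‖²_F + ‖C̊‖²_F) through Hamilton's blocks and ∫|W|² = 4∫w are PROVED as
`Literature.Geometry.Riemannian.weylNormSq_eq_four_mul` / `weylEnergy_eq_lintegral_four_mul`; the
card's w(Σ) < 8π² with the Yamabe-positive class represented by its PSC member). Rev 1
(route-repair): the inline frame-wise density integrated against `riemVolume` (whose home module
dragged the Ricci-flow cone in) is replaced by `weylEnergy`; mathematically the same statement, and
the T₃/measurable binders are no longer needed (`weylEnergy` integrates against the Borel Riemannian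
measure internally). [difficulty: open-problem] -/
@[route_item "route-SmoothPoincare4-WeylBudget", crux]
def WeylLight : Prop :=
  ∀ S : Literature.Topology.FourManifolds.HomotopySphere 4, ∃ g : Literature.Geometry.Lorentzian.PseudoRiemannianMetric (𝓡 4) ∞ (EuclideanSpace ℝ (Fin 4)) (TangentSpace (𝓡 4) : S.carrier → Type _), ∃ _ : g.HasLeviCivita, g.IsRiemannian ∧ (∀ x, 0 < g.scalarCurvature x) ∧ g.weylEnergy < ENNReal.ofReal (32 * Real.pi ^ 2)

-- earlier CorkRegluingBudget (stmt-SmoothPoincare4-3205, replaced 2026-08-15T16:24:50Z -> stmt-SmoothPoincare4-10831): retired by None — ∀ (S : Literature.Topology.FourManifolds.HomotopySphere 4), ∃ (C : Type) (_ : TopologicalSpace C) (_ : ChartedSpace (EuclideanHalfSpace 4) C) (_ : IsManifold (𝓡∂ 4) ∞ C) (V : Type) (_ : TopologicalSpace V) (_ : ChartedSpace (EuclideanHalfSpace 4) V) (_ : IsManifold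
/-- item stmt-SmoothPoincare4-10831 · crux · rank 2 · open · by planner
why it might fail: the regluable-PSC class on S⁴ (metric AND 2nd fundamental form τ-invariant along the cork boundary Y) may be empty — only its mean-convex half is free (LawsonMichelsohn1984, review gen-2) — or its Weyl infimum may be ≥ 32π² (bending energy of the knotted homology sphere Y ⊂ S⁴; CS floor ≤ 6π²).
sources: ChangGurskyYang2003, CurtisFreedmanHsiangStong1996, Matveyev1996, AkbulutMatveyev1998, BarHanke2023, KirbyCorks1996
[crux] for every homotopy 4-sphere Σ there are a compact contractible piece C and an exterior piece
V (smooth 4-manifolds with boundary), smooth embeddings jC, jV covering S⁴ and kC, kV covering Σ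
(pieces meeting only along ∂C-images — the cork-twist presentation of the cork theorem), and
Riemannian metrics g on S⁴, γ on Σ inducing THE SAME piece metrics (jC*g = kC*γ, jV*g = kV*γ:
isometric regluing), with scal_g > 0 and Weyl energy `g.weylEnergy` < 32π² ((0,4)-norm of
WeylEnergy.lean; = 8π² operator norm). Card item X_cork: κ(e,τ) < 8π², PSC-representative form. Rev
1 (route-repair): the Weyl bound restated through the fact-free `weylEnergy` (was the inline block
density against `riemVolume`); same statement mathematically. [difficulty: open-problem] -/
@[route_item "route-SmoothPoincare4-WeylBudget", crux]
def CorkRegluingBudget : Prop :=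
  ∀ (S : Literature.Topology.FourManifolds.HomotopySphere 4), ∃ (C : Type) (_ : TopologicalSpace C) (_ : ChartedSpace (EuclideanHalfSpace 4) C) (_ : IsManifold (𝓡∂ 4) ∞ C) (V : Type) (_ : TopologicalSpace V) (_ : ChartedSpace (EuclideanHalfSpace 4) V) (_ : IsManifold (𝓡∂ 4) ∞ V) (jC : C → (Metric.sphere (0 : EuclideanSpace ℝ (Fin 5)) 1)) (jV : V → (Metric.sphere (0 : EuclideanSpace ℝ (Fin 5)) 1)) (kC : C → S.carrier) (kV : V → S.carrier) (g : Literature.Geometry.Lorentzian.PseudoRiemannianMetric (𝓡 4) ∞ (EuclideanSpace ℝ (Fin 4)) (TangentSpace (𝓡 4) : (Metric.sphere (0 : EuclideanSpace ℝ (Fin 5)) 1) → Type _)) (γ : Literature.Geometry.Lorentzian.PseudoRiemannianMetric (𝓡 4) ∞ (EuclideanSpace ℝ (Fin 4)) (TangentSpace (𝓡 4) : S.carrier → Type _)), CompactSpace C ∧ ContractibleSpace C ∧ Manifold.IsSmoothEmbedding (𝓡∂ 4) (𝓡 4) ∞ jC ∧ Manifold.IsSmoothEmbedding (𝓡∂ 4)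 (𝓡 4) ∞ jV ∧ Set.range jC ∪ Set.range jV = Set.univ ∧ (∀ c v, jC c = jV v → c ∈ (𝓡∂ 4).boundary C) ∧ Manifold.IsSmoothEmbedding (𝓡∂ 4) (𝓡 4) ∞ kC ∧ Manifold.IsSmoothEmbedding (𝓡∂ 4) (𝓡 4) ∞ kV ∧ Set.range kC ∪ Set.range kV = Set.univ ∧ (∀ c v, kC c = kV v → c ∈ (𝓡∂ 4).boundary C) ∧ (∀ c, Literature.Geometry.Lorentzian.pullbackBilin (I := 𝓡 4) (I' := 𝓡∂ 4) jC g.val c = Literature.Geometry.Lorentzian.pullbackBilin (I := 𝓡 4) (I' := 𝓡∂ 4) kC γ.val c) ∧ (∀ v, Literature.Geometry.Lorentzian.pullbackBilin (I := 𝓡 4) (I' := 𝓡∂ 4) jV g.val v = Literature.Geometry.Lorentzian.pullbackBilin (I := 𝓡 4) (I' := 𝓡∂ 4) kV γ.val v) ∧ g.IsRiemannian ∧ γ.IsRiemannian ∧ ∃ _ : g.HasLeviCivita, (∀ x, 0 < g.scalarCurvature x) ∧ g.weylEnergy < ENNReal.ofReal (32 * Real.pi ^ 2)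

/-- item stmt-SmoothPoincare4-3206 · crux · rank 3 · open · by planner
why it might fail: PSC boundary deformations are mean-curvature monotone from ONE side (BarHanke2023 master theorem), so a two-sided τ-symmetric germ along a hyperbolic homology sphere Y ⊂ S⁴ may be obstructed (a 'PSC wall'); it implies PSC on every homotopy 4-sphere, open (KumarSen2025: only up to homeomorphism).
sources: BarHanke2023, GromovLawson1980, AkbulutMatveyev1998, KumarSen2025, SchoenYau1979
[crux] the qualitative half of the budget crux: every homotopy 4-sphere is an ISOMETRIC cork
regluing of SOME positive-scalar-curvature metric on S⁴ (same presentation data, no Weyl bound).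
Everything is built on the standard sphere: a PSC metric on S⁴ whose normal jet along the cork
boundary Y is τ-invariant; it already yields PSC on every homotopy 4-sphere (support
RegluablePscGivesPsc = route PIC's crux PicPscV2). [difficulty: L] -/
@[route_item "route-SmoothPoincare4-WeylBudget", crux]
def CorkRegluablePsc : Prop :=
  ∀ (S : Literature.Topology.FourManifolds.HomotopySphere 4), ∃ (C : Type) (_ : TopologicalSpace C) (_ : ChartedSpace (EuclideanHalfSpace 4) C) (_ : IsManifold (𝓡∂ 4) ∞ C) (V : Type) (_ : TopologicalSpace V) (_ : ChartedSpace (EuclideanHalfSpace 4) V) (_ : IsManifold (𝓡∂ 4) ∞ V) (jC : C → (Metric.sphere (0 : EuclideanSpace ℝ (Fin 5)) 1)) (jV : V → (Metric.sphere (0 : EuclideanSpace ℝ (Fin 5)) 1)) (kC : C → S.carrier) (kV : V → S.carrier) (g : Literature.Geometry.Lorentzian.PseudoRiemannianMetric (𝓡 4) ∞ (EuclideanSpace ℝ (Fin 4)) (TangentSpace (𝓡 4) : (Metric.sphere (0 : EuclideanSpace ℝ (Fin 5)) 1) → Type _)) (γ : Literature.Geometry.Lorentzian.PseudoRiemannianMetric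 (𝓡 4) ∞ (EuclideanSpace ℝ (Fin 4)) (TangentSpace (𝓡 4) : S.carrier → Type _)), CompactSpace C ∧ ContractibleSpace C ∧ Manifold.IsSmoothEmbedding (𝓡∂ 4) (𝓡 4) ∞ jC ∧ Manifold.IsSmoothEmbedding (𝓡∂ 4) (𝓡 4) ∞ jV ∧ Set.range jC ∪ Set.range jV = Set.univ ∧ (∀ c v, jC c = jV v → c ∈ (𝓡∂ 4).boundary C) ∧ Manifold.IsSmoothEmbedding (𝓡∂ 4) (𝓡 4) ∞ kC ∧ Manifold.IsSmoothEmbedding (𝓡∂ 4) (𝓡 4) ∞ kV ∧ Set.range kC ∪ Set.range kV = Set.univ ∧ (∀ c v, kC c = kV v → c ∈ (𝓡∂ 4).boundary C) ∧ (∀ c, Literature.Geometry.Lorentzian.pullbackBilin (I := 𝓡 4) (I' := 𝓡∂ 4) jC g.val c = Literature.Geometry.Lorentzian.pullbackBilin (I := 𝓡 4) (I' := 𝓡∂ 4) kC γ.val c) ∧ (∀ v, Literature.Geometry.Lorentzian.pullbackBilin (I := 𝓡 4) (I' := 𝓡∂ 4) jV g.val v = Literature.Geometry.Lorentzian.pullbackBilin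 (I := 𝓡 4) (I' := 𝓡∂ 4) kV γ.val v) ∧ g.IsRiemannian ∧ γ.IsRiemannian ∧ ∃ _ : g.HasLeviCivita, (∀ x, 0 < g.scalarCurvature x)

-- earlier WeylLightGluck (stmt-SmoothPoincare4-3207, replaced 2026-08-15T16:24:50Z -> stmt-SmoothPoincare4-10832): retired by None — ∀ (K : Literature.Topology.FourManifolds.TwoKnot) (X : Type) [TopologicalSpace X] [T2Space X] [SecondCountableTopology X] [ChartedSpace (EuclideanSpace ℝ (Fin 4)) X] [IsManifold (𝓡 4) ∞ X] [T3Space X] [MeasurableSpace X] [BorelSpace X], Literature.Topology.FourManifold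
/-- item stmt-SmoothPoincare4-10832 · crux · rank 4 · open · by planner
why it might fail: the Gluck map is an isometry of NO metric on S²×S¹ (its powers are C¹-unbounded), so regluing is never isometric: the twisted filling of S²×D² has a fixed Weyl cost and making S⁴ PSC-product-like near a knotted K costs bending energy; the sum may exceed 32π² ((0,4)-norm) even for ribbon knots.
sources: Gluck1962, ChangGurskyYang2003, MicallefWang1993, Hoelzel2016
[crux] test family: every Gluck twist X of S⁴ along a 2-knot K carries a PSC metric with Weyl energy
`g.weylEnergy` < 32π² ((0,4)-norm; = 8π² operator norm) (card crux 3: twisted-filling cost c_tw of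
S²×D² with the Gluck boundary germ plus the conformal bending energy of K stays under budget). Mod
CGY this is the Gluck twist conjecture, attacked by an energy estimate instead of handle moves. Rev
1 (route-repair): `weylEnergy` form; the T₃/measurable binders of rev 0 are dropped (`weylEnergy`
integrates against the Borel Riemannian measure internally). [difficulty: open-problem] -/
@[route_item "route-SmoothPoincare4-WeylBudget", crux]
def WeylLightGluck : Prop :=
  ∀ (K : Literature.Topology.FourManifolds.TwoKnot) (X : Type) [TopologicalSpace X] [T2Space X] [SecondCountableTopology X] [ChartedSpace (EuclideanSpace ℝ (Fin 4)) X] [IsManifold (𝓡 4) ∞ X], Literature.Topology.FourManifolds.IsGluckTwist (𝓡 4) X K → ∃ g : Literature.Geometry.Lorentzian.PseudoRiemannianMetric (𝓡 4) ∞ (EuclideanSpace ℝ (Fin 4)) (TangentSpace (𝓡 4) : X → Type _), ∃ _ : g.HasLeviCivita, g.IsRiemannian ∧ (∀ x, 0 < g.scalarCurvature x) ∧ g.weylEnergy < ENNReal.ofReal (32 * Real.pi ^ 2)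

/-- item stmt-SmoothPoincare4-10834 · support · rank 9 · closed · proved by Summit.SmoothPoincare4.SmoothPoincare4.Theorems.MargerinRails.ChangGurskyYang_weylBudget_proof @ 331fc5878e1d (prover) · by planner
why it might fail: Published theorem (CGY 2003 Thm A + Lee–Parker (1.5)/Thm 2.2, Hatcher 3.30, π₁(ℝP⁴) ≠ 1); the risks are vendoring fidelity only (C^∞ metric with HasLeviCivita, weylEnergy normalisation (0.3), 32π² ≤ 16π²χ) and that a Lean proof is far out of reach.
sources: ChangGurskyYang2003, arXiv:math/0309287, doi:10.1007/s10240-003-0017-z, Margerin1998, LeeParker1987, HatcherAT2002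
[support] NAMED-FACT ITEM — Chang–Gursky–Yang 2003 Thm A, simply connected scal > 0 case, VERBATIM
the text of the Literature named fact `Literature.Geometry.Riemannian.changGurskyYang_sphere_four`
(ChangGurskyYang.lean; deep theorem — fully nonlinear conformal PDE + Margerin's weak pinching —
hence no `_holds`): a compact simply connected Hausdorff second-countable smooth 4-manifold carrying
a C^∞ Riemannian metric (with its Levi-Civita connection) of everywhere positive scalar curvature
and Weyl energy `g.weylEnergy` = ∫|W|² dV < 32π² ((0,4)-norm |W|² = W_ijkl W^ijkl of
WeylEnergy.lean; = 8π² in the End(Λ²)-norm of the thesis,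
`changGurskyYang_sphere_four.of_hamiltonBlocks`) is diffeomorphic to S⁴. It is the recognition step
of the deciding theorem `closes` (WeylLight → ChangGurskyYang → SmoothPoincare4). Inlined rather
than imported so that the route's dependency cone stays fact-free (ChangGurskyYang.lean §Cone
hygiene: 'a route that wants the fact takes it as an explicit hypothesis or inlines its text'); it
closes by `exact h` from any discharge `h : changGurskyYang_sphere_four`. NOT a prover task.
needs-fact: Literature.Geometry.Riemannian.changGurskyYang_sphere_four. [difficu -/
@[route_item "route-SmoothPoincare4-WeylBudget", crux]
def ChangGurskyYang : Prop :=
  ∀ (M : Type) [TopologicalSpace M] [T2Space M] [SecondCountableTopology M] [ChartedSpace (EuclideanSpace ℝ (Fin 4)) M] [IsManifold (𝓡 4) ∞ M] [CompactSpace M] [SimplyConnectedSpace M], (∃ g : Literature.Geometry.Lorentzian.PseudoRiemannianMetric (𝓡 4) ∞ (EuclideanSpace ℝ (Fin 4)) (TangentSpace (𝓡 4) : M → Type _), ∃ _ : g.HasLeviCivita, g.IsRiemannian ∧ (∀ x, 0 < g.scalarCurvature x) ∧ g.weylEnergy < ENNReal.ofReal (32 * Real.pi ^ 2)) → Nonempty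 (M ≃ₘ⟮𝓡 4, 𝓡 4⟯ Metric.sphere (0 : EuclideanSpace ℝ (Fin 5)) 1)

/-- item stmt-SmoothPoincare4-3208 · support · rank 9 · closed · proved by Summit.SmoothPoincare4.SmoothPoincare4.Theorems.budgetTransfer_proof @ 037849741836 (prover) · by planner
sources: Besse1987, ONeill1983, Federer1969
[support] transfer lemma (the card's engine, analysis-free): an isometric regluing transports scalar
curvature pointwise (naturality of Levi-Civita/curvature under local isometries on the open piece
interiors, continuity + compactness of S⁴ at seam points) and preserves the Weyl energy (piece
boundaries are null sets, embeddings are measure-preserving onto their images); hence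
CorkRegluingBudget → WeylLight. [difficulty: L] -/
@[route_item "route-SmoothPoincare4-WeylBudget", crux]
def BudgetTransfer : Prop :=
  CorkRegluingBudget → WeylLight

/-- item stmt-SmoothPoincare4-3209 · support · rank 9 · closed · proved by Summit.SmoothPoincare4.SmoothPoincare4.Theorems.regluablePscGivesPsc_proof (prover) · by planner
sources: ONeill1983, Besse1987
[support] the same locality argument without the energy bookkeeping: CorkRegluablePsc gives a PSC
metric on every homotopy 4-sphere (conclusion stated verbatim as route PIC's crux PicPscV2, so
closing CorkRegluablePsc closes stmt-SmoothPoincare4-0442 through this glue). [difficulty: M] -/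
@[route_item "route-SmoothPoincare4-WeylBudget", crux]
def RegluablePscGivesPsc : Prop :=
  CorkRegluablePsc → ∀ S : Literature.Topology.FourManifolds.HomotopySphere 4, ∃ g : Literature.Geometry.Lorentzian.PseudoRiemannianMetric (𝓡 4) ∞ (EuclideanSpace ℝ (Fin 4)) (TangentSpace (𝓡 4) : S.carrier → Type _), ∃ _ : g.HasLeviCivita, g.IsRiemannian ∧ ∀ x, 0 < g.scalarCurvature x

-- earlier Assembly (stmt-SmoothPoincare4-3210, replaced 2026-08-15T16:24:50Z -> stmt-SmoothPoincare4-10833): retired by None — (∀ (M : Type) [TopologicalSpace M] [T2Space M] [SecondCountableTopology M] [ChartedSpace (EuclideanSpace ℝ (Fin 4)) M] [IsManifold (𝓡 4) ∞ M] [CompactSpace M] [SimplyConnectedSpace M] [T3Space M] [MeasurableSpace M] [BorelSpace M], (∃ g : Literature.Geometry.Lorentzian.Pseud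
/-- item stmt-SmoothPoincare4-10833 · assembly · rank 1 · closed · proved by Summit.SmoothPoincare4.SmoothPoincare4.Theorems.weylBudget_assembly_proof (prover) · by planner
sources: ChangGurskyYang2003, HatcherAT2002, LeeSmoothManifolds2013
[assembly] ChangGurskyYang → CorkRegluingBudget → BudgetTransfer → SmoothPoincare4: BudgetTransfer
turns the cork budget into WeylLight, the packaging argument of the deciding theorem `closes`
(compactness, simple connectivity and orientability of M ≃ₕ S⁴ by the proved `_holds` facts) makes M
a `HomotopySphere 4`, WeylLight gives the Weyl-light PSC metric and ChangGurskyYang returns M ≃ₘ S⁴.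
Rev 1 (route-repair): the inline CGY hypothesis of rev 0 is now the listed item ChangGurskyYang;
provable now (planner's Sketch.lean `assembly_holds`, axioms propext/Classical.choice/Quot.sound).
[difficulty: provable-now] -/
@[route_item "route-SmoothPoincare4-WeylBudget", crux]
def Assembly : Prop :=
  ChangGurskyYang → CorkRegluingBudget → BudgetTransfer → _root_.SmoothPoincare4

/-! D-0027 §2.1 — DECIDING THEOREM (planner-authored via `route open/edit --closes-file`; by planner-rbadge-SmoothPoincare4-WeylBudget-070d83c1-g4-0 2026-08-15T16:24:50Z):
its hypotheses are this route's items and its conclusion the sub-problem Statement (glue_lint), and it elaborates with this file. -/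

@[closes "route-SmoothPoincare4-WeylBudget"] theorem closes (hW : WeylLight) (hCGY : ChangGurskyYang)
    (_hB : CorkRegluingBudget) (_hP : CorkRegluablePsc) (_hG : WeylLightGluck)
    (_hT : BudgetTransfer) (_hR : RegluablePscGivesPsc) (_hA : Assembly) :
    _root_.SmoothPoincare4 := by
  unfold _root_.SmoothPoincare4 Literature.SPC4.SmoothPoincareConjectureFour
    ContinuousMap.HomotopyEquiv.NonemptyDiffeomorphSphere
  intro M _ _ _ _ _ e
  haveI : CompactSpace M :=
    Literature.Topology.FourManifolds.compactSpace_of_homotopyEquiv_sphere_four_holds M e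
  haveI : SimplyConnectedSpace (Metric.sphere (0 : EuclideanSpace ℝ (Fin 5)) 1) :=
    Literature.Topology.FourManifolds.simplyConnectedSpace_sphere_four_holds
  haveI : SimplyConnectedSpace M := e.simplyConnectedSpace
  obtain ⟨o⟩ := Literature.Topology.FourManifolds.isOrientable_of_homotopyEquiv_sphere_four_holds M e
  obtain ⟨g, hLC, hg, hscal, hint⟩ :=
    hW { carrier := M, orientation := o, nonempty_homotopyEquiv := ⟨e⟩ }
  exact hCGY M ⟨g, hLC, hg, hscal, hint⟩

end Summit.SmoothPoincare4.SmoothPoincare4.Theses.WeylBudget
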